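import Summits.QuantumFields.BalabanUV.Beta.GAN24.ScaledPartFF
import Summits.QuantumFields.BalabanUV.Beta.GAN24.FibreUniformBoundOfParts

/-!
# `BalabanUV.Beta.GAN24.ScaledPartFFStep` — binder row G-an2-4 / (CONV-C), road P1-fibre, leaf **P1-L09** `FibreUniformBound`, part **H1** (c):
# the NAMED SHAPE `FibreUniformBound.ScaledFF (d := 3) Lc (sfStep Lc) K₁` DISCHARGED with `K₁ = xFF 4 Lc / Lc²`

NOT IN PRINT; OUR PROOF ATTEMPT.  HONEST FRAMING (cell contract, verbatim): «discharging `BetaPertH` makes Bałaban's UV stability UNCONDITIONAL — a real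
constructive-QFT result; it is NOT the continuum limit and NOT the Clay problem.»  HONEST DEPENDENCY (verbatim): «continuum YM on T⁴ ⇐ BetaPertH ∧ nine spine
estimates (0/9 proved); BetaPertH ⇐ (D1) ∧ (D4) ∧ CAP+tail; G-an2-4 gates asym, D1 and NE2/3/4.»  [folklore] one-line packaging of `ScaledPartFF.scaledFF_three`
into leaf-05's hypothesis shape (row P1-L09 part 1, `FibreUniformBoundOfParts`); no estimate, no cited fact, no wall binder, no `def`.  NOT summit progress; nothing of
(CONV-C)'s K-slot `GAN24.CombesThomas.ConvCK 3 Lc` is discharged here; NOT `BetaPertH`, NOT continuum, NOT Clay.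
Unit `b2b-balaban-gan24-formalise-leaf-03` (G-an2-4 formalisation swarm, leaf prover 03, gen 6), 2026-08-20.
-/

noncomputable section

open scoped Real

namespace Summit.QuantumFields.BalabanUV.Beta.GAN24.ScaledPartFF

open CombesThomas (sfStep)
open FibreUniformBound (ScaledFF)

/-- [folklore] **H1 OF ROW P1-L09 IN THE ASSEMBLER'S NAMED SHAPE**: `ScaledFF (d := 3) Lc (sfStep Lc) (xFF 4 Lc / Lc²)` — for every step `j`, every
`q ∈ BZ 4 ∖ {0}` and all legs `κ l x′ y′`, `sfStep Lc j ^ 2 · Σ_m ‖readW(m,κ,x′)‖·‖Â_κ(m)[f̂(l,y′)]‖ ≤ xFF 4 Lc / Lc²` (`scaledFF_three`; `q ∈ BZ` ↦ `|q_i| ≤ π`). -/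
theorem scaledFF_step (Lc : ℕ) [NeZero Lc] : ScaledFF (d := 3) Lc (sfStep Lc) (xFF 4 Lc / (Lc : ℝ) ^ 2) := by
  intro j q hq hq0 κ l x' y'
  exact scaledFF_three Lc j (fun i => abs_le.2 ⟨hq.1 i, hq.2 i⟩) hq0 κ l x' y'

end Summit.QuantumFields.BalabanUV.Beta.GAN24.ScaledPartFF

end
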